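import Summits.Ventures.PercRepro.S1CoreCapEightThreeDis

/-!
# PercRepro — THE EXACT VALUE `Q*(8) = 23`: THREE PAIRWISE DISJOINT BIG LINES (p1, gen 29)

Case (A0) of the three non-planar big lines with its own constant: `S1CoreCapEightThreeDis` proves
`sum_cap_le_twenty_five_of_three_disjoint` by showing `≤ 23` in every branch (the sub-configuration trick
`sum_cap_le_twenty_three_of_chordUnique`, or a contradiction from three hubs with two chords each); this module
states the same proof as `sum_cap_le_twenty_three_of_three_disjoint`, the form the exact assembly
`S1CoreCapEightExact` needs. `proofs/P1-S4-CAPBRIDGE.md` §21. Axioms: standard.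
-/

namespace PercRepro

namespace S1

namespace FourCap

namespace Eight

open Seven

variable {β : Type} [DecidableEq β]

section ThreeDisjoint

variable {w : β → ℕ} {ls : Finset (Finset β)}
  (h1 : ∀ L ∈ ls, ∀ v ∈ L, w v = 1 ∨ w v = 2)
  (h2 : ∀ L ∈ ls, 3 ≤ L.card ∧ wsum w L ≤ 5)
  (h3 : ∀ L ∈ ls, ∀ L' ∈ ls, L ≠ L' → (L ∩ L').card ≤ 1)
  (h4 : ∀ l : List (Finset β), l.Nodup → (∀ L ∈ l, L ∈ ls) → wsum w (unionL l) ≤ 8 + lineRank l)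
  (h5 : ∀ l : List (Finset β), l.Nodup → (∀ L ∈ l, L ∈ ls) → lineRank l ≤ 3 → (unionL l).card ≤ 9)
  {A B C : Finset β} (hA : A ∈ ls) (hB : B ∈ ls) (hC : C ∈ ls)
  (hBA : B ≠ A) (hCA : C ≠ A) (hCB : C ≠ B)
  (cA : 4 ≤ A.card) (cB : 4 ≤ B.card) (cC : 4 ≤ C.card)
  (hrest : ∀ L ∈ ls, L ≠ A → L ≠ B → L ≠ C → L.card = 3)

include h1 h2 h3 h4 h5 hA hB hC hBA hCA hCB cA cB cC hrest in
/-- **(A0) at nullity `8`, exact: three pairwise disjoint big lines: cap sum `≤ 23`** (the proof of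
`sum_cap_le_twenty_five_of_three_disjoint` with its own constant): some pair has at most one chord per hub (then
the sub-configuration trick gives `≤ 18 + cap C ≤ 23`), or three hubs with two chords each exist and the plane
device makes their chords three free lines over `[C, B, A]`, against the budget. -/
theorem sum_cap_le_twenty_three_of_three_disjoint (d12 : (B ∩ A).card = 0) (d13 : (C ∩ A).card = 0)
    (d23 : (C ∩ B).card = 0) : ∑ L ∈ ls, capPaper L.card (fat w L) ≤ 23 := by
  by_cases uAB : ∀ v, v ∉ A ∪ B → ∀ c ∈ ls.erase C, ∀ c' ∈ ls.erase C, c ≠ A → c ≠ B → c' ≠ A → c' ≠ B →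
      v ∈ c → v ∈ c' → (c ∩ (A ∪ B)).card = 2 → (c' ∩ (A ∪ B)).card = 2 → c = c'
  · exact (sum_cap_le_twenty_three_of_chordUnique h1 h2 h3 h4 hA hB hC hBA hCA hCB cA cB cC hrest d12 uAB)
  by_cases uAC : ∀ v, v ∉ A ∪ C → ∀ c ∈ ls.erase B, ∀ c' ∈ ls.erase B, c ≠ A → c ≠ C → c' ≠ A → c' ≠ C →
      v ∈ c → v ∈ c' → (c ∩ (A ∪ C)).card = 2 → (c' ∩ (A ∪ C)).card = 2 → c = c'
  · exact (sum_cap_le_twenty_three_of_chordUnique h1 h2 h3 h4 hA hC hB hCA hBA hCB.symm cA cC cB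
      (fun L hL hLA hLC hLB => hrest L hL hLA hLB hLC) d13 uAC)
  by_cases uBC : ∀ v, v ∉ B ∪ C → ∀ c ∈ ls.erase A, ∀ c' ∈ ls.erase A, c ≠ B → c ≠ C → c' ≠ B → c' ≠ C →
      v ∈ c → v ∈ c' → (c ∩ (B ∪ C)).card = 2 → (c' ∩ (B ∪ C)).card = 2 → c = c'
  · exact (sum_cap_le_twenty_three_of_chordUnique h1 h2 h3 h4 hB hC hA hCB hBA.symm hCA.symm cB cC cA
      (fun L hL hLB hLC hLA => hrest L hL hLA hLB hLC) d23 uBC)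
  exfalso
  push Not at uAB uAC uBC
  obtain ⟨v₁, hv₁, Y₁, hY₁, Y₁', hY₁', hY₁A, hY₁B, hY₁'A, hY₁'B, hvY₁, hvY₁', hY₁2, hY₁'2, hY₁ne⟩ := uAB
  obtain ⟨v₂, hv₂, Y₂, hY₂, Y₂', hY₂', hY₂A, hY₂C, hY₂'A, hY₂'C, hvY₂, hvY₂', hY₂2, hY₂'2, hY₂ne⟩ := uAC
  obtain ⟨v₃, hv₃, Y₃, hY₃, Y₃', hY₃', hY₃B, hY₃C, hY₃'B, hY₃'C, hvY₃, hvY₃', hY₃2, hY₃'2, hY₃ne⟩ := uBC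
  have hY₁C := (Finset.mem_erase.1 hY₁).1
  have hY₁'C := (Finset.mem_erase.1 hY₁').1
  have hY₂B := (Finset.mem_erase.1 hY₂).1
  have hY₂'B := (Finset.mem_erase.1 hY₂').1
  have hY₃A := (Finset.mem_erase.1 hY₃).1
  have hY₃'A := (Finset.mem_erase.1 hY₃').1
  have hY₁s := (Finset.mem_erase.1 hY₁).2
  have hY₁'s := (Finset.mem_erase.1 hY₁').2
  have hY₂s := (Finset.mem_erase.1 hY₂).2
  have hY₂'s := (Finset.mem_erase.1 hY₂').2
  have hY₃s := (Finset.mem_erase.1 hY₃).2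
  have hY₃'s := (Finset.mem_erase.1 hY₃').2
  have k₁ := hrest Y₁ hY₁s hY₁A hY₁B hY₁C
  have k₁' := hrest Y₁' hY₁'s hY₁'A hY₁'B hY₁'C
  have k₂ := hrest Y₂ hY₂s hY₂A hY₂B hY₂C
  have k₂' := hrest Y₂' hY₂'s hY₂'A hY₂'B hY₂'C
  have k₃ := hrest Y₃ hY₃s hY₃A hY₃B hY₃C
  have k₃' := hrest Y₃' hY₃'s hY₃'A hY₃'B hY₃'C
  -- the three planes
  have hP₁ := subset_plane_of_two_chords h3 h5 hA hB hBA cA cB d12 hv₁ hY₁s hY₁'s hY₁ne hY₁A hY₁B hY₁'A hY₁'B k₁ k₁'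
    hvY₁ hvY₁' hY₁2 hY₁'2
  have hP₂ := subset_plane_of_two_chords h3 h5 hA hC hCA cA cC d13 hv₂ hY₂s hY₂'s hY₂ne hY₂A hY₂C hY₂'A hY₂'C k₂ k₂'
    hvY₂ hvY₂' hY₂2 hY₂'2
  -- the structure of the chords
  obtain ⟨hY₁A1, hY₁B1, hY₁sub⟩ := chord_structure k₁ (h3 Y₁ hY₁s A hA hY₁A) (h3 Y₁ hY₁s B hB hY₁B) hv₁ hvY₁ hY₁2
  obtain ⟨hY₁'A1, hY₁'B1, hY₁'sub⟩ :=
    chord_structure k₁' (h3 Y₁' hY₁'s A hA hY₁'A) (h3 Y₁' hY₁'s B hB hY₁'B) hv₁ hvY₁' hY₁'2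
  obtain ⟨hY₂A1, hY₂C1, hY₂sub⟩ := chord_structure k₂ (h3 Y₂ hY₂s A hA hY₂A) (h3 Y₂ hY₂s C hC hY₂C) hv₂ hvY₂ hY₂2
  obtain ⟨hY₂'A1, hY₂'C1, hY₂'sub⟩ :=
    chord_structure k₂' (h3 Y₂' hY₂'s A hA hY₂'A) (h3 Y₂' hY₂'s C hC hY₂'C) hv₂ hvY₂' hY₂'2
  obtain ⟨hY₃B1, hY₃C1, hY₃sub⟩ := chord_structure k₃ (h3 Y₃ hY₃s B hB hY₃B) (h3 Y₃ hY₃s C hC hY₃C) hv₃ hvY₃ hY₃2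
  obtain ⟨hY₃'B1, hY₃'C1, hY₃'sub⟩ :=
    chord_structure k₃' (h3 Y₃' hY₃'s B hB hY₃'B) (h3 Y₃' hY₃'s C hC hY₃'C) hv₃ hvY₃' hY₃'2
  have dAB : ∀ u, u ∈ A → u ∈ B → False := fun u huA huB => by
    have : u ∈ B ∩ A := Finset.mem_inter.2 ⟨huB, huA⟩
    rw [Finset.card_eq_zero.1 d12] at this
    exact Finset.notMem_empty u this
  have dAC : ∀ u, u ∈ A → u ∈ C → False := fun u huA huC => by
    have : u ∈ C ∩ A := Finset.mem_inter.2 ⟨huC, huA⟩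
    rw [Finset.card_eq_zero.1 d13] at this
    exact Finset.notMem_empty u this
  have dBC : ∀ u, u ∈ B → u ∈ C → False := fun u huB huC => by
    have : u ∈ C ∩ B := Finset.mem_inter.2 ⟨huC, huB⟩
    rw [Finset.card_eq_zero.1 d23] at this
    exact Finset.notMem_empty u this
  -- two points of a line in a set
  have two_le : ∀ (Y P : Finset β) (p q : β), p ∈ Y → p ∈ P → q ∈ Y → q ∈ P → p ≠ q → 2 ≤ (Y ∩ P).card := by
    intro Y P p q hpY hpP hqY hqP hpq
    have hsub : ({p, q} : Finset β) ⊆ Y ∩ P := by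
      intro x hx
      simp only [Finset.mem_insert, Finset.mem_singleton] at hx
      rcases hx with rfl | rfl
      · exact Finset.mem_inter.2 ⟨hpY, hpP⟩
      · exact Finset.mem_inter.2 ⟨hqY, hqP⟩
    have := Finset.card_le_card hsub
    rwa [Finset.card_pair hpq] at this
  -- two distinct lines of the configuration share at most one point: two common points collide
  have collide : ∀ Y Y' : Finset β, Y ∈ ls → Y' ∈ ls → Y ≠ Y' → ∀ p q, p ∈ Y → p ∈ Y' → q ∈ Y → q ∈ Y' →
      p ≠ q → False := by
    intro Y Y' hY hY' hne p q hpY hpY' hqY hqY' hpq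
    have := two_le Y Y' p q hpY hpY' hqY hqY' hpq
    have := h3 Y hY Y' hY' hne
    omega
  -- a point of a line of the plane `L₁ ∪ L₂ ∪ {v}` on a line disjoint from `L₁, L₂` is the hub
  have third : ∀ (L₁ L₂ : Finset β) (v : β), (∀ X ∈ ls, 2 ≤ (X ∩ (L₁ ∪ L₂ ∪ {v})).card → X ⊆ L₁ ∪ L₂ ∪ {v}) →
      ∀ Y ∈ ls, ∀ p q, p ∈ Y → p ∈ L₁ ∪ L₂ ∪ {v} → q ∈ Y → q ∈ L₁ ∪ L₂ ∪ {v} → p ≠ q →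
      ∀ r, r ∈ Y → r ∉ L₁ → r ∉ L₂ → r = v := by
    intro L₁ L₂ v hPl Y hY p q hpY hpP hqY hqP hpq r hrY hr₁ hr₂
    have := hPl Y hY (two_le Y _ p q hpY hpP hqY hqP hpq) hrY
    rcases Finset.mem_union.1 this with h | h
    · rcases Finset.mem_union.1 h with h | h
      · exact (hr₁ h).elim
      · exact (hr₂ h).elim
    · exact Finset.mem_singleton.1 h
  have exists_pt : ∀ (Y L : Finset β), (Y ∩ L).card = 1 → ∃ x, x ∈ Y ∧ x ∈ L := by
    intro Y L h
    obtain ⟨x, hx⟩ := Finset.card_eq_one.1 h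
    have : x ∈ Y ∩ L := hx ▸ Finset.mem_singleton_self x
    exact ⟨x, (Finset.mem_inter.1 this).1, (Finset.mem_inter.1 this).2⟩
  obtain ⟨a₁, ha₁Y, ha₁A⟩ := exists_pt Y₁ A hY₁A1
  obtain ⟨b₁, hb₁Y, hb₁B⟩ := exists_pt Y₁ B hY₁B1
  obtain ⟨a₁', ha₁'Y, ha₁'A⟩ := exists_pt Y₁' A hY₁'A1
  obtain ⟨b₁', hb₁'Y, hb₁'B⟩ := exists_pt Y₁' B hY₁'B1
  obtain ⟨a₂, ha₂Y, ha₂A⟩ := exists_pt Y₂ A hY₂A1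
  obtain ⟨c₂, hc₂Y, hc₂C⟩ := exists_pt Y₂ C hY₂C1
  obtain ⟨a₂', ha₂'Y, ha₂'A⟩ := exists_pt Y₂' A hY₂'A1
  obtain ⟨c₂', hc₂'Y, hc₂'C⟩ := exists_pt Y₂' C hY₂'C1
  obtain ⟨b₃, hb₃Y, hb₃B⟩ := exists_pt Y₃ B hY₃B1
  obtain ⟨c₃, hc₃Y, hc₃C⟩ := exists_pt Y₃ C hY₃C1
  obtain ⟨b₃', hb₃'Y, hb₃'B⟩ := exists_pt Y₃' B hY₃'B1
  obtain ⟨c₃', hc₃'Y, hc₃'C⟩ := exists_pt Y₃' C hY₃'C1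
  have hv₁A : v₁ ∉ A := fun h => hv₁ (Finset.mem_union_left _ h)
  have hv₁B : v₁ ∉ B := fun h => hv₁ (Finset.mem_union_right _ h)
  have hv₂A : v₂ ∉ A := fun h => hv₂ (Finset.mem_union_left _ h)
  have hv₂C : v₂ ∉ C := fun h => hv₂ (Finset.mem_union_right _ h)
  have hv₃B : v₃ ∉ B := fun h => hv₃ (Finset.mem_union_left _ h)
  have hv₃C : v₃ ∉ C := fun h => hv₃ (Finset.mem_union_right _ h)
  have memA : ∀ x, x ∈ A → x ∈ A ∪ B ∪ {v₁} := fun x hx => Finset.mem_union_left _ (Finset.mem_union_left _ hx)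
  have memB : ∀ x, x ∈ B → x ∈ A ∪ B ∪ {v₁} := fun x hx => Finset.mem_union_left _ (Finset.mem_union_right _ hx)
  have memV₁ : v₁ ∈ A ∪ B ∪ {v₁} := Finset.mem_union_right _ (Finset.mem_singleton_self v₁)
  have memA' : ∀ x, x ∈ A → x ∈ A ∪ C ∪ {v₂} := fun x hx => Finset.mem_union_left _ (Finset.mem_union_left _ hx)
  have memC' : ∀ x, x ∈ C → x ∈ A ∪ C ∪ {v₂} := fun x hx => Finset.mem_union_left _ (Finset.mem_union_right _ hx)
  have memV₂ : v₂ ∈ A ∪ C ∪ {v₂} := Finset.mem_union_right _ (Finset.mem_singleton_self v₂)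
  -- (C1) `v₂ ∉ B`
  have hv₂B : v₂ ∉ B := by
    intro hv₂B
    have e := third A B v₁ hP₁ Y₂ hY₂s v₂ a₂ hvY₂ (memB v₂ hv₂B) ha₂Y (memA a₂ ha₂A)
      (fun e => dAB v₂ (e ▸ ha₂A) hv₂B) c₂ hc₂Y (fun h => dAC c₂ h hc₂C) (fun h => dBC c₂ h hc₂C)
    have e' := third A B v₁ hP₁ Y₂' hY₂'s v₂ a₂' hvY₂' (memB v₂ hv₂B) ha₂'Y (memA a₂' ha₂'A)
      (fun e => dAB v₂ (e ▸ ha₂'A) hv₂B) c₂' hc₂'Y (fun h => dAC c₂' h hc₂'C) (fun h => dBC c₂' h hc₂'C)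
    exact collide Y₂ Y₂' hY₂s hY₂'s hY₂ne v₂ v₁ hvY₂ hvY₂' (e ▸ hc₂Y) (e' ▸ hc₂'Y) (fun h => hv₁B (h ▸ hv₂B))
  -- (C2) `v₃ ∉ A`
  have hv₃A : v₃ ∉ A := by
    intro hv₃A
    have e := third A B v₁ hP₁ Y₃ hY₃s v₃ b₃ hvY₃ (memA v₃ hv₃A) hb₃Y (memB b₃ hb₃B)
      (fun e => dAB v₃ hv₃A (e ▸ hb₃B)) c₃ hc₃Y (fun h => dAC c₃ h hc₃C) (fun h => dBC c₃ h hc₃C)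
    have e' := third A B v₁ hP₁ Y₃' hY₃'s v₃ b₃' hvY₃' (memA v₃ hv₃A) hb₃'Y (memB b₃' hb₃'B)
      (fun e => dAB v₃ hv₃A (e ▸ hb₃'B)) c₃' hc₃'Y (fun h => dAC c₃' h hc₃'C) (fun h => dBC c₃' h hc₃'C)
    exact collide Y₃ Y₃' hY₃s hY₃'s hY₃ne v₃ v₁ hvY₃ hvY₃' (e ▸ hc₃Y) (e' ▸ hc₃'Y) (fun h => hv₁A (h ▸ hv₃A))
  -- (C3) `v₁ ∉ C`
  have hv₁C : v₁ ∉ C := by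
    intro hv₁C
    have e := third A C v₂ hP₂ Y₁ hY₁s v₁ a₁ hvY₁ (memC' v₁ hv₁C) ha₁Y (memA' a₁ ha₁A)
      (fun e => dAC v₁ (e ▸ ha₁A) hv₁C) b₁ hb₁Y (fun h => dAB b₁ h hb₁B) (fun h => dBC b₁ hb₁B h)
    have e' := third A C v₂ hP₂ Y₁' hY₁'s v₁ a₁' hvY₁' (memC' v₁ hv₁C) ha₁'Y (memA' a₁' ha₁'A)
      (fun e => dAC v₁ (e ▸ ha₁'A) hv₁C) b₁' hb₁'Y (fun h => dAB b₁' h hb₁'B) (fun h => dBC b₁' hb₁'B h)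
    exact collide Y₁ Y₁' hY₁s hY₁'s hY₁ne v₁ v₂ hvY₁ hvY₁' (e ▸ hb₁Y) (e' ▸ hb₁'Y) (fun h => hv₂C (h ▸ hv₁C))
  -- (C4) `v₁ ≠ v₂`
  have h12 : v₁ ≠ v₂ := by
    intro e
    have e' := third A B v₁ hP₁ Y₂ hY₂s v₂ a₂ hvY₂ (e ▸ memV₁) ha₂Y (memA a₂ ha₂A)
      (fun e'' => hv₂A (e'' ▸ ha₂A)) c₂ hc₂Y (fun h => dAC c₂ h hc₂C) (fun h => dBC c₂ h hc₂C)
    exact hv₂C (e ▸ e' ▸ hc₂C)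
  -- (C5) `v₁ ≠ v₃`
  have h13 : v₁ ≠ v₃ := by
    intro e
    have e' := third A B v₁ hP₁ Y₃ hY₃s v₃ b₃ hvY₃ (e ▸ memV₁) hb₃Y (memB b₃ hb₃B)
      (fun e'' => hv₃B (e'' ▸ hb₃B)) c₃ hc₃Y (fun h => dAC c₃ h hc₃C) (fun h => dBC c₃ h hc₃C)
    exact hv₃C (e ▸ e' ▸ hc₃C)
  -- (C6) `v₂ ≠ v₃`
  have h23 : v₂ ≠ v₃ := by
    intro e
    have e' := third A C v₂ hP₂ Y₃ hY₃s v₃ c₃ hvY₃ (e ▸ memV₂) hc₃Y (memC' c₃ hc₃C)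
      (fun e'' => hv₃C (e'' ▸ hc₃C)) b₃ hb₃Y (fun h => dAB b₃ h hb₃B) (fun h => dBC b₃ hb₃B h)
    exact hv₃B (e ▸ e' ▸ hb₃B)
  -- the hubs are off `P₀ = C ∪ (B ∪ (A ∪ ∅))` and off the other chords
  have hv₁P : v₁ ∉ unionL [C, B, A] := by
    simp only [unionL, Finset.union_empty, Finset.mem_union, not_or]
    exact ⟨hv₁C, hv₁B, hv₁A⟩
  have hv₂P : v₂ ∉ unionL [C, B, A] := by
    simp only [unionL, Finset.union_empty, Finset.mem_union, not_or]
    exact ⟨hv₂C, hv₂B, hv₂A⟩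
  have hv₃P : v₃ ∉ unionL [C, B, A] := by
    simp only [unionL, Finset.union_empty, Finset.mem_union, not_or]
    exact ⟨hv₃C, hv₃B, hv₃A⟩
  have notmem : ∀ (L₁ L₂ : Finset β) (v u : β) (Y : Finset β), Y ⊆ L₁ ∪ L₂ ∪ {v} → u ∉ L₁ → u ∉ L₂ → u ≠ v →
      u ∉ Y := by
    intro L₁ L₂ v u Y hY hu₁ hu₂ huv huY
    rcases Finset.mem_union.1 (hY huY) with h | h
    · rcases Finset.mem_union.1 h with h | h
      · exact hu₁ h
      · exact hu₂ h
    · exact huv (Finset.mem_singleton.1 h)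
  have hv₁Y₂ : v₁ ∉ Y₂ := notmem A C v₂ v₁ Y₂ hY₂sub hv₁A hv₁C h12
  have hv₁Y₃ : v₁ ∉ Y₃ := notmem B C v₃ v₁ Y₃ hY₃sub hv₁B hv₁C h13
  have hv₂Y₁ : v₂ ∉ Y₁ := notmem A B v₁ v₂ Y₁ hY₁sub hv₂A hv₂B (Ne.symm h12)
  have hv₂Y₃ : v₂ ∉ Y₃ := notmem B C v₃ v₂ Y₃ hY₃sub hv₂B hv₂C h23
  have hv₃Y₁ : v₃ ∉ Y₁ := notmem A B v₁ v₃ Y₁ hY₁sub hv₃A hv₃B (Ne.symm h13)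
  have hv₃Y₂ : v₃ ∉ Y₂ := notmem A C v₂ v₃ Y₂ hY₂sub hv₃A hv₃C (Ne.symm h23)
  have hY₁₂ : Y₁ ≠ Y₂ := fun e => hv₁Y₂ (e ▸ hvY₁)
  have hY₁₃ : Y₁ ≠ Y₃ := fun e => hv₁Y₃ (e ▸ hvY₁)
  have hY₂₃ : Y₂ ≠ Y₃ := fun e => hv₂Y₃ (e ▸ hvY₂)
  -- three free lines over the three big lines
  have hfree : freeCountR (unionL [C, B, A]) [Y₃, Y₂, Y₁] = 3 := by
    have := freeCountR_eq_length_of_off (unionL [C, B, A]) [Y₃, Y₂, Y₁] (by simp [Ne.symm hY₁₂,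
      Ne.symm hY₁₃, Ne.symm hY₂₃]) (by
      intro L hL
      simp only [List.mem_cons, List.not_mem_nil, or_false] at hL
      rcases hL with rfl | rfl | rfl
      · exact ⟨v₃, hvY₃, hv₃P, fun L' hL' hne => by
          simp only [List.mem_cons, List.not_mem_nil, or_false] at hL'
          rcases hL' with rfl | rfl | rfl
          · exact (hne rfl).elim
          · exact hv₃Y₂
          · exact hv₃Y₁⟩
      · exact ⟨v₂, hvY₂, hv₂P, fun L' hL' hne => by
          simp only [List.mem_cons, List.not_mem_nil, or_false] at hL'
          rcases hL' with rfl | rfl | rfl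
          · exact hv₂Y₃
          · exact (hne rfl).elim
          · exact hv₂Y₁⟩
      · exact ⟨v₁, hvY₁, hv₁P, fun L' hL' hne => by
          simp only [List.mem_cons, List.not_mem_nil, or_false] at hL'
          rcases hL' with rfl | rfl | rfl
          · exact hv₁Y₃
          · exact hv₁Y₂
          · exact (hne rfl).elim⟩)
    simpa using this
  have h2' := two_le_card_of_spec₇ h2
  have hb := budget_of_prefix h1 h2' h4 [C, B, A] [Y₃, Y₂, Y₁] (by
    simp [Ne.symm hY₁₂, Ne.symm hY₁₃, Ne.symm hY₂₃, hY₁A, hY₁B, hY₁C, hY₂A, hY₂B, hY₂C, hY₃A,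
      hY₃B, hY₃C, hBA, hCA, hCB])
    (by
      intro L hL
      simp only [List.mem_append, List.mem_cons, List.not_mem_nil, or_false] at hL
      rcases hL with (rfl | rfl | rfl) | (rfl | rfl | rfl)
      · exact hY₃s
      · exact hY₂s
      · exact hY₁s
      · exact hC
      · exact hB
      · exact hA)
    (by
      intro L hL
      simp only [List.mem_cons, List.not_mem_nil, or_false] at hL
      rcases hL with rfl | rfl | rfl
      · exact k₃
      · exact k₂
      · exact k₁)
  rw [hfree] at hb
  have hmono := fat_mono w (subset_unionLR (unionL [C, B, A]) [Y₃, Y₂, Y₁])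
  simp only [costSum, unionL, Finset.union_empty] at hb hmono
  rw [lineCost_empty, lineCost_of_inter_le_two (by omega),
    lineCost_of_inter_le_two (le_trans (card_inter_union_le C B A) (by omega))] at hb
  omega

end ThreeDisjoint

end Eight

end FourCap

end S1

end PercRepro
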